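import Summits.QuantumAdvantage.QuantumAdvantage.Theorems.LinnikCubicClassGroupsDegreeOnePrimesEscapeClassShortIntervalDH
import Summits.QuantumAdvantage.QuantumAdvantage.Theorems.LinnikCubicClassGroupsDegreeOnePrimesEscapeShortIntervalPrimes
import Summits.QuantumAdvantage.QuantumAdvantage.Theorems.LinnikCubicClassGroupsDegreeOnePrimesEscapeLeastPrimeIdeal
import Summits.QuantumAdvantage.QuantumAdvantage.Theorems.LinnikCubicClassGroupsDegreeOnePrimesEscapeClassPNTNoExceptionalDegOne
import HarnessLib

/-!
# Prime ideals of a class in short intervals with Deuring–Heilbronn, V: prime ideals of every class in every short interval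

Topic `Summits/QuantumAdvantage/QuantumAdvantage/Theorems`, cell B2b-1 (linnik-cubic), PART A (gen 19); helper
toward the crux `DegreeOnePrimesEscape` (stmt-QuantumAdvantage-11543) of route `LinnikCubicClassGroups`.
HONEST FRAMING: the value of this file is a THEOREM (kernel-checked, GRH-free, Siegel-free) — NOT summit progress.

**Hoheisel–Linnik for ideal classes, every class of every number field, unconditionally.**
* `classTheta_shortInterval_lower` — `h_K(θ_C(x+h) − θ_C(x)) ≥ (c₁/8)·Q^{−2}·h` for `x ≥ Q^{a}`, `x^{1−δ} ≤ h ≤ x`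
  (`Q = |d_K|·nⁿ`; the prime powers of `ψ_C` are negligible);
* `exists_prime_mem_class_absNorm_mem_Ioc` — for every `n > 1` there are `δ, L > 0` such that EVERY ideal class of
  EVERY number field `K` of degree `n` contains a prime ideal `𝔭` with `x < N𝔭 ≤ x + h`, for every `x ≥ |d_K|^L` and
  `x^{1−δ} ≤ h ≤ x`;
* `exists_degOnePrime_mem_class_absNorm_mem_Ioc` — the same with `N𝔭 = p` a rational prime (a DEGREE-ONE prime).
Gen 5 proved this for odd degree / for the classes with `χ₁(C) = −1` (`exists_prime_mem_class_absNorm_mem_Ioc_of_odd`);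
the flat classes `χ₁(C) = +1` in even degree need the Deuring–Heilbronn phenomenon (files I–IV).  With `h = x` it
contains the cell's Linnik theorem for ideal classes (`exists_prime_mem_class_absNorm_le_discr`, gen 4).
In print: Balog–Ono 2001 / Gun–Naik 2024 (short-interval Chebotarev, absolute error, hence an exceptional-class
proviso in the Linnik range); Fogels 1962 (intervals `(x, x·D^ε)`).
References: G. Hoheisel (1930); [LagariasMontgomeryOdlyzko1979, §7]; [ThornerZaman2019, Thm. 3.1]; [Weiss1983, Thm. 5.2].
-/

noncomputable section

open Complex Real
open scoped NumberField nonZeroDivisors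

namespace Summit.QuantumAdvantage.QuantumAdvantage.Theorems.DegreeOnePrimesEscape

open Literature.NumberTheory.LFunctions Literature.NumberTheory.LFunctions.NumberField
  Literature.NumberTheory.LFunctions.AbelianDensity

/-! ### From `ψ_C` to `θ_C` -/

set_option maxHeartbeats 1600000 in
/-- **`θ_C` in every short interval of the Linnik range, every class of every number field of degree `n`**:
there are `δ ∈ (0,1/64]`, `a ≥ 1`, `c₁ ∈ (0,1]` with `h_K(θ_C(x+h) − θ_C(x)) ≥ (c₁/8)·Q^{−2}·h` for `x ≥ Q^{a}`,
`x^{1−δ} ≤ h ≤ x`, unconditionally. -/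
theorem classTheta_shortInterval_lower (n : ℕ) (hn : 1 < n) :
    ∃ δ a c₁ : ℝ, 0 < δ ∧ δ ≤ 1 / 64 ∧ 1 ≤ a ∧ 0 < c₁ ∧ c₁ ≤ 1 ∧
    ∀ (K : Type) [Field K] [NumberField K], Module.finrank ℚ K = n →
      ∀ (C : ClassGroup (𝓞 K)) (x h : ℝ), ThornerZaman.condQn K ^ a ≤ x → x ^ (1 - δ) ≤ h → h ≤ x →
        c₁ / 8 * ThornerZaman.condQn K ^ (-(2 : ℝ)) * h ≤
          (NumberField.classNumber K : ℝ) *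
            (chebyshevThetaIdealClass K C (x + h) - chebyshevThetaIdealClass K C x) := by
  obtain ⟨δ, a, c₁, hδ, hδ64, ha, hc₁, hc₁1, hmain⟩ := classPsi_shortInterval_lower n hn
  obtain ⟨a₂, ha₂, habs⟩ := absorb_junk (32 / c₁) 1 (by positivity) one_pos le_rfl
  refine ⟨δ, max a a₂, c₁, hδ, hδ64, le_max_of_le_left ha, hc₁, hc₁1, fun K _ _ hKn C x h hx hhx hhx' ↦ ?_⟩
  have hK : 1 < Module.finrank ℚ K := by rw [hKn]; exact hn
  set Q : ℝ := ThornerZaman.condQn K with hQ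
  have hQ12 : (12 : ℝ) ≤ Q := ThornerZaman.twelve_le_condQn (K := K) hK
  have hQ1 : (1 : ℝ) ≤ Q := by linarith
  have hQ0 : (0 : ℝ) < Q := by linarith
  have hxa : Q ^ a ≤ x := (Real.rpow_le_rpow_of_exponent_le hQ1 (le_max_left _ _)).trans hx
  have hxa₂ : Q ^ a₂ ≤ x := (Real.rpow_le_rpow_of_exponent_le hQ1 (le_max_right _ _)).trans hx
  have hQx : Q ≤ x := by
    have := (Real.rpow_le_rpow_of_exponent_le hQ1 (ha.trans (le_max_left a a₂))).trans hx
    rwa [Real.rpow_one] at this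
  have hx1 : 1 ≤ x := by linarith
  have hx0 : 0 < x := by linarith
  have hlow := hmain K hKn C x h hxa hhx hhx'
  have hh0 : 0 < h := lt_of_lt_of_le (Real.rpow_pos_of_pos hx0 _) hhx
  -- the prime powers: `h_K (ψ_C − θ_C)(x+h) ≤ h_K · 2n √(x+h) log(x+h) ≤ (c₁/8) Q^{-2} h`
  have hnQ : (Module.finrank ℚ K : ℝ) ≤ Q := ThornerZaman.finrank_le_condQn (K := K)
  have hhK : (NumberField.classNumber K : ℝ) ≤ Q ^ (4 : ℕ) := ThornerZaman.classNumber_le_condQn_pow (K := K) hK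
  have hh1 : (0 : ℝ) ≤ (NumberField.classNumber K : ℝ) := Nat.cast_nonneg _
  have hpp := classPsi_sub_theta_le_sqrt (K := K) C (show (1 : ℝ) ≤ x + h by linarith)
  have hθψ := chebyshevThetaIdealClass_le_classPsi (K := K) C x
  have hsqrt : Real.sqrt (x + h) ≤ 2 * x ^ ((1 : ℝ) / 2) := by
    rw [Real.sqrt_eq_rpow]
    have h1 : (x + h) ^ ((1 : ℝ) / 2) ≤ (4 * x) ^ ((1 : ℝ) / 2) :=
      Real.rpow_le_rpow (by linarith) (by linarith) (by norm_num)
    have h2 : (4 * x) ^ ((1 : ℝ) / 2) = 2 * x ^ ((1 : ℝ) / 2) := by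
      rw [Real.mul_rpow (by norm_num) hx0.le]
      congr 1
      rw [show (4 : ℝ) = 2 ^ (2 : ℕ) by norm_num, ← Real.rpow_natCast, ← Real.rpow_mul (by norm_num)]
      norm_num
    linarith
  have hlogxh : Real.log (x + h) ≤ Real.log x + 1 := by
    have h1 : Real.log (x + h) ≤ Real.log (2 * x) := Real.log_le_log (by linarith) (by linarith)
    rw [Real.log_mul (by norm_num) hx0.ne'] at h1
    have h2 : Real.log 2 < 0.6931471808 := Real.log_two_lt_d9
    linarith
  have hlog0 : 0 ≤ Real.log (x + h) := Real.log_nonneg (by linarith)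
  have hl1 : 0 ≤ Real.log x + 1 := by have := Real.log_nonneg hx1; linarith
  have habs' := habs Q x hQ12 hxa₂
  -- `x^{1/2} = x^{−1/4}·x^{3/4}`, `x^{3/4} ≤ x^{1−δ} ≤ h`, `Q² · Q^{-2} = 1`
  have hx34 : x ^ ((1 : ℝ) / 2) = x ^ (-((1 : ℝ) / 4)) * x ^ ((3 : ℝ) / 4) := by
    rw [← Real.rpow_add hx0]; norm_num
  have hx34h : x ^ ((3 : ℝ) / 4) ≤ h := (Real.rpow_le_rpow_of_exponent_le hx1 (by linarith)).trans hhx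
  have hQm2 : 0 < Q ^ (-(2 : ℝ)) := Real.rpow_pos_of_pos hQ0 _
  have hQ52 : Q ^ (5 : ℕ) = Q ^ (7 : ℕ) * Q ^ (-(2 : ℝ)) := by
    rw [show (Q ^ (7 : ℕ) : ℝ) = Q ^ (7 : ℝ) from (Real.rpow_natCast Q 7).symm, ← Real.rpow_add hQ0,
      show (Q ^ (5 : ℕ) : ℝ) = Q ^ (5 : ℝ) from (Real.rpow_natCast Q 5).symm]
    norm_num
  have hA : 4 * Q ^ (7 : ℕ) * (Real.log x + 1) * x ^ ((1 : ℝ) / 2) ≤ c₁ / 8 * h := by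
    rw [hx34]
    calc 4 * Q ^ (7 : ℕ) * (Real.log x + 1) * (x ^ (-((1 : ℝ) / 4)) * x ^ ((3 : ℝ) / 4))
        = (c₁ / 8) * ((32 / c₁) * Q ^ (7 : ℕ) * (Real.log x + 1) * x ^ (-((1 : ℝ) / 4))) * x ^ ((3 : ℝ) / 4) := by
          field_simp; ring
      _ ≤ (c₁ / 8) * 1 * h := mul_le_mul (mul_le_mul_of_nonneg_left habs' (by positivity)) hx34h
          (by positivity) (by positivity)
      _ = c₁ / 8 * h := by ring
  have hkey : (NumberField.classNumber K : ℝ) * (2 * Module.finrank ℚ K * Real.sqrt (x + h) * Real.log (x + h)) ≤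
      c₁ / 8 * Q ^ (-(2 : ℝ)) * h := by
    calc (NumberField.classNumber K : ℝ) * (2 * Module.finrank ℚ K * Real.sqrt (x + h) * Real.log (x + h))
        ≤ Q ^ (4 : ℕ) * (2 * Q * (2 * x ^ ((1 : ℝ) / 2)) * (Real.log x + 1)) := by
          refine mul_le_mul hhK (mul_le_mul (mul_le_mul (by linarith) hsqrt (Real.sqrt_nonneg _) (by positivity))
            hlogxh hlog0 (by positivity)) (by positivity) (by positivity)
      _ = 4 * Q ^ (5 : ℕ) * (Real.log x + 1) * x ^ ((1 : ℝ) / 2) := by ring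
      _ = (4 * Q ^ (7 : ℕ) * (Real.log x + 1) * x ^ ((1 : ℝ) / 2)) * Q ^ (-(2 : ℝ)) := by rw [hQ52]; ring
      _ ≤ (c₁ / 8 * h) * Q ^ (-(2 : ℝ)) := mul_le_mul_of_nonneg_right hA hQm2.le
      _ = c₁ / 8 * Q ^ (-(2 : ℝ)) * h := by ring
  have hpp' := mul_le_mul_of_nonneg_left hpp hh1
  have hθψ' := mul_le_mul_of_nonneg_left hθψ hh1
  have e : c₁ / 8 * Q ^ (-(2 : ℝ)) * h = c₁ / 4 * Q ^ (-(2 : ℝ)) * h - c₁ / 8 * Q ^ (-(2 : ℝ)) * h := by ring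
  rw [e]
  nlinarith [hlow, hkey, hpp', hθψ']

/-! ### Prime ideals of every class in every short interval -/

/-- **Hoheisel–Linnik for ideal classes**: for every `n > 1` there are `δ, L > 0` such that for EVERY number field
`K` of degree `n`, EVERY ideal class `C` of `K`, every `x ≥ |d_K|^L` and every `x^{1−δ} ≤ h ≤ x` there is a PRIME
IDEAL `𝔭 ∈ C` with `x < N𝔭 ≤ x + h` — unconditionally (GRH-free, Siegel-free; the flat classes are handled by the
Deuring–Heilbronn phenomenon). [cite: LagariasMontgomeryOdlyzko1979, §7] [cite: Weiss1983, Theorem 5.2] -/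
theorem exists_prime_mem_class_absNorm_mem_Ioc (n : ℕ) (hn : 1 < n) :
    ∃ δ L : ℝ, 0 < δ ∧ 0 < L ∧ ∀ (K : Type) [Field K] [NumberField K], Module.finrank ℚ K = n →
      ∀ (C : ClassGroup (𝓞 K)) (x h : ℝ), ((NumberField.discr K).natAbs : ℝ) ^ L ≤ x → x ^ (1 - δ) ≤ h → h ≤ x →
        ∃ P : Ideal (𝓞 K), P.IsPrime ∧ x < (Ideal.absNorm P : ℝ) ∧ (Ideal.absNorm P : ℝ) ≤ x + h ∧
          ∃ hP : P ∈ (Ideal (𝓞 K))⁰, ClassGroup.mk0 ⟨P, hP⟩ = C := by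
  obtain ⟨δ, a, c₁, hδ, -, ha, hc₁, -, hmain⟩ := classTheta_shortInterval_lower n hn
  set e : ℝ := 1 + n * Real.log n / Real.log 3 with he
  have hn0 : (0 : ℝ) < n := by exact_mod_cast (lt_trans Nat.zero_lt_one hn)
  have hlogn : 0 ≤ Real.log n := Real.log_nonneg (by exact_mod_cast hn.le)
  have he1 : 1 ≤ e := by
    have : 0 ≤ n * Real.log n / Real.log 3 := div_nonneg (mul_nonneg hn0.le hlogn) (Real.log_nonneg (by norm_num))
    rw [he]; linarith
  refine ⟨δ, e * a, hδ, by positivity, fun K _ _ hKn C x h hx hhx hhx' ↦ ?_⟩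
  have hK : 1 < Module.finrank ℚ K := by rw [hKn]; exact hn
  have hQ12 : (12 : ℝ) ≤ ThornerZaman.condQn K := ThornerZaman.twelve_le_condQn (K := K) hK
  have hd1 : (1 : ℝ) ≤ ((NumberField.discr K).natAbs : ℝ) := by
    have := NumberField.abs_discr_gt_two hK
    rw [Nat.cast_natAbs]; exact_mod_cast (show (1 : ℤ) ≤ |NumberField.discr K| by omega)
  have hQd : ThornerZaman.condQn K ≤ ((NumberField.discr K).natAbs : ℝ) ^ e := by
    have := condQn_le_natAbs_discr_rpow K hK; rwa [hKn, ← he] at this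
  have hxa : ThornerZaman.condQn K ^ a ≤ x := by
    refine le_trans ?_ hx
    rw [Real.rpow_mul (by linarith)]
    exact Real.rpow_le_rpow (by linarith) hQd (by linarith)
  have hQx : ThornerZaman.condQn K ≤ x := by
    have := (Real.rpow_le_rpow_of_exponent_le (by linarith : (1 : ℝ) ≤ ThornerZaman.condQn K) ha).trans hxa
    rwa [Real.rpow_one] at this
  have hx1 : 1 ≤ x := by linarith
  have hx0 : 0 < x := by linarith
  have hh0 : 0 < h := lt_of_lt_of_le (Real.rpow_pos_of_pos hx0 _) hhx
  have hθ := hmain K hKn C x h hxa hhx hhx'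
  have hQm2 : 0 < ThornerZaman.condQn K ^ (-(2 : ℝ)) := Real.rpow_pos_of_pos (by linarith) _
  have hhKpos : (0 : ℝ) < (NumberField.classNumber K : ℝ) := by
    exact_mod_cast lt_of_lt_of_le Nat.zero_lt_one (one_le_classNumber (K := K))
  have hpos : 0 < chebyshevThetaIdealClass K C (x + h) - chebyshevThetaIdealClass K C x := by
    have h1 : 0 < c₁ / 8 * ThornerZaman.condQn K ^ (-(2 : ℝ)) * h := by positivity
    exact pos_of_mul_pos_right (lt_of_lt_of_le h1 hθ) hhKpos.le
  exact exists_prime_of_theta_sub_pos C hx1 hh0.le hpos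

/-! ### Degree-one prime ideals of every class in every short interval -/

/-- `θ_C(x+h) − θ_C(x) ≤ (π_C(x+h) − π_C(x)) · log(x+h)` (`1 ≤ x`, `0 ≤ h`). [folklore] -/
theorem chebyshevThetaIdealClass_sub_le_count_sub_mul_log {K : Type} [Field K] [NumberField K]
    (C : ClassGroup (𝓞 K)) {x h : ℝ} (hx : 1 ≤ x) (hh : 0 ≤ h) :
    chebyshevThetaIdealClass K C (x + h) - chebyshevThetaIdealClass K C x ≤
      ((primeIdealClassCount K C (x + h) : ℝ) - primeIdealClassCount K C x) * Real.log (x + h) := by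
  classical
  have hx0 : (0 : ℝ) ≤ x := by linarith
  have hxh0 : (0 : ℝ) ≤ x + h := by linarith
  set S := (finite_primeIdealsInClassLE (K := K) C x).toFinset with hS
  set T := (finite_primeIdealsInClassLE (K := K) C (x + h)).toFinset with hT
  have hST : S ⊆ T := by
    intro P hP
    rw [hS, Set.Finite.mem_toFinset] at hP
    rw [hT, Set.Finite.mem_toFinset]
    obtain ⟨h1, h2, h3⟩ := hP
    exact ⟨h1, h2.trans (by linarith), h3⟩
  rw [chebyshevThetaIdealClass_eq_sum_primeIdealsInClassLE K C hxh0, chebyshevThetaIdealClass_eq_sum_primeIdealsInClassLE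
    K C hx0, ← hS, ← hT, primeIdealClassCount, primeIdealClassCount,
    Set.ncard_eq_toFinset_card _ (finite_primeIdealsInClassLE C (x + h)),
    Set.ncard_eq_toFinset_card _ (finite_primeIdealsInClassLE C x), ← hS, ← hT,
    ← Finset.sum_sdiff hST, add_sub_cancel_right]
  have hcard : ((T \ S).card : ℝ) = (T.card : ℝ) - S.card := by
    rw [Finset.card_sdiff_of_subset hST, Nat.cast_sub (Finset.card_le_card hST)]
  rw [← hcard]
  have h := Finset.sum_le_card_nsmul (T \ S) (fun P : Ideal (𝓞 K) ↦ Real.log (Ideal.absNorm P : ℝ))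
    (Real.log (x + h)) (fun P hP ↦ ?_)
  · rwa [nsmul_eq_mul] at h
  · rw [Finset.mem_sdiff, hT, Set.Finite.mem_toFinset] at hP
    obtain ⟨⟨-, hle, hP0, -⟩, -⟩ := hP
    have hpos : (0 : ℝ) < (Ideal.absNorm P : ℝ) := by
      exact_mod_cast Ideal.absNorm_pos_iff_mem_nonZeroDivisors.mpr hP0
    exact Real.log_le_log hpos hle

set_option maxHeartbeats 1600000 in
/-- **Hoheisel–Linnik for DEGREE-ONE prime ideals of every class**: for every `n > 1` there are `δ, L > 0` such that
for EVERY number field `K` of degree `n`, EVERY ideal class `C`, every `x ≥ |d_K|^L` and `x^{1−δ} ≤ h ≤ x` there is a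
prime ideal `𝔭 ∈ C` whose norm is a rational prime `p` with `x < p ≤ x + h` — unconditionally.
[cite: LagariasMontgomeryOdlyzko1979, §7] [cite: Weiss1983, Theorem 5.2] -/
theorem exists_degOnePrime_mem_class_absNorm_mem_Ioc (n : ℕ) (hn : 1 < n) :
    ∃ δ L : ℝ, 0 < δ ∧ 0 < L ∧ ∀ (K : Type) [Field K] [NumberField K], Module.finrank ℚ K = n →
      ∀ (C : ClassGroup (𝓞 K)) (x h : ℝ), ((NumberField.discr K).natAbs : ℝ) ^ L ≤ x → x ^ (1 - δ) ≤ h → h ≤ x →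
        ∃ P : Ideal (𝓞 K), (Ideal.absNorm P).Prime ∧ x < (Ideal.absNorm P : ℝ) ∧ (Ideal.absNorm P : ℝ) ≤ x + h ∧
          ∃ hP : P ∈ (Ideal (𝓞 K))⁰, ClassGroup.mk0 ⟨P, hP⟩ = C := by
  classical
  obtain ⟨δ, a, c₁, hδ, hδ64, ha, hc₁, hc₁1, hmain⟩ := classTheta_shortInterval_lower n hn
  obtain ⟨a₂, ha₂, habs⟩ := absorb_junk (96 / c₁) 1 (by positivity) one_pos le_rfl
  set e : ℝ := 1 + n * Real.log n / Real.log 3 with he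
  have hn0 : (0 : ℝ) < n := by exact_mod_cast (lt_trans Nat.zero_lt_one hn)
  have hlogn : 0 ≤ Real.log n := Real.log_nonneg (by exact_mod_cast hn.le)
  have he1 : 1 ≤ e := by
    have : 0 ≤ n * Real.log n / Real.log 3 := div_nonneg (mul_nonneg hn0.le hlogn) (Real.log_nonneg (by norm_num))
    rw [he]; linarith
  have hamax : 1 ≤ max a a₂ := le_max_of_le_left ha
  refine ⟨δ, e * max a a₂, hδ, by positivity, fun K _ _ hKn C x h hx hhx hhx' ↦ ?_⟩
  have hK : 1 < Module.finrank ℚ K := by rw [hKn]; exact hn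
  set Q : ℝ := ThornerZaman.condQn K with hQ
  have hQ12 : (12 : ℝ) ≤ Q := ThornerZaman.twelve_le_condQn (K := K) hK
  have hQ1 : (1 : ℝ) ≤ Q := by linarith
  have hQ0 : (0 : ℝ) < Q := by linarith
  have hd1 : (1 : ℝ) ≤ ((NumberField.discr K).natAbs : ℝ) := by
    have := NumberField.abs_discr_gt_two hK
    rw [Nat.cast_natAbs]; exact_mod_cast (show (1 : ℤ) ≤ |NumberField.discr K| by omega)
  have hQd : Q ≤ ((NumberField.discr K).natAbs : ℝ) ^ e := by
    have := condQn_le_natAbs_discr_rpow K hK; rwa [hKn, ← he] at this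
  have hxmax : Q ^ (max a a₂) ≤ x := by
    refine le_trans ?_ hx
    rw [Real.rpow_mul (by linarith)]
    exact Real.rpow_le_rpow hQ0.le hQd (by linarith)
  have hxa : Q ^ a ≤ x := (Real.rpow_le_rpow_of_exponent_le hQ1 (le_max_left _ _)).trans hxmax
  have hxa₂ : Q ^ a₂ ≤ x := (Real.rpow_le_rpow_of_exponent_le hQ1 (le_max_right _ _)).trans hxmax
  have hQx : Q ≤ x := by
    have := (Real.rpow_le_rpow_of_exponent_le hQ1 hamax).trans hxmax
    rwa [Real.rpow_one] at this
  have hx1 : 1 ≤ x := by linarith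
  have hx0 : 0 < x := by linarith
  have hh0 : 0 < h := lt_of_lt_of_le (Real.rpow_pos_of_pos hx0 _) hhx
  have hθ := hmain K hKn C x h hxa hhx hhx'
  have hQm2 : 0 < Q ^ (-(2 : ℝ)) := Real.rpow_pos_of_pos hQ0 _
  have hhK1 : (1 : ℝ) ≤ (NumberField.classNumber K : ℝ) := by exact_mod_cast one_le_classNumber (K := K)
  have hhKpos : (0 : ℝ) < (NumberField.classNumber K : ℝ) := by linarith
  have hhK : (NumberField.classNumber K : ℝ) ≤ Q ^ (4 : ℕ) := ThornerZaman.classNumber_le_condQn_pow (K := K) hK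
  have hnQ : (Module.finrank ℚ K : ℝ) ≤ Q := ThornerZaman.finrank_le_condQn (K := K)
  -- counting: `π_C(x+h) − π_C(x) ≥ Δθ_C / log(x+h)`, `π_C(x+h) − #deg1(x+h) ≤ n(√(x+h)+1)`, `#deg1(x) ≤ π_C(x)`
  have hcount := chebyshevThetaIdealClass_sub_le_count_sub_mul_log C hx1 hh0.le
  have hdeg := primeIdealClassCount_sub_degOneClassCount_le K C (show (0 : ℝ) ≤ x + h by linarith)
  have hdeg1 : (degOneClassCount K C x : ℝ) ≤ primeIdealClassCount K C x := by
    exact_mod_cast degOneClassCount_le K C x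
  have hlogxh0 : 0 < Real.log (x + h) := Real.log_pos (by linarith)
  have hlogxh : Real.log (x + h) ≤ Real.log x + 1 := by
    have h1 : Real.log (x + h) ≤ Real.log (2 * x) := Real.log_le_log (by linarith) (by linarith)
    rw [Real.log_mul (by norm_num) hx0.ne'] at h1
    have h2 : Real.log 2 < 0.6931471808 := Real.log_two_lt_d9
    linarith
  have hsqrt : Real.sqrt (x + h) + 1 ≤ 3 * x ^ ((1 : ℝ) / 2) := by
    rw [Real.sqrt_eq_rpow]
    have h1 : (x + h) ^ ((1 : ℝ) / 2) ≤ (4 * x) ^ ((1 : ℝ) / 2) :=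
      Real.rpow_le_rpow (by linarith) (by linarith) (by norm_num)
    have h2 : (4 * x) ^ ((1 : ℝ) / 2) = 2 * x ^ ((1 : ℝ) / 2) := by
      rw [Real.mul_rpow (by norm_num) hx0.le]
      congr 1
      rw [show (4 : ℝ) = 2 ^ (2 : ℕ) by norm_num, ← Real.rpow_natCast, ← Real.rpow_mul (by norm_num)]
      norm_num
    have h3 : (1 : ℝ) ≤ x ^ ((1 : ℝ) / 2) := Real.one_le_rpow hx1 (by norm_num)
    linarith
  -- the size condition: `h_K · n(√(x+h)+1) · log(x+h) < (c₁/8) Q^{-2} h`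
  have habs' := habs Q x hQ12 hxa₂
  have hx34 : x ^ ((1 : ℝ) / 2) = x ^ (-((1 : ℝ) / 4)) * x ^ ((3 : ℝ) / 4) := by
    rw [← Real.rpow_add hx0]; norm_num
  have hx34h : x ^ ((3 : ℝ) / 4) ≤ h := (Real.rpow_le_rpow_of_exponent_le hx1 (by linarith)).trans hhx
  have hl1 : 0 ≤ Real.log x + 1 := by have := Real.log_nonneg hx1; linarith
  have hQ52 : Q ^ (5 : ℕ) = Q ^ (7 : ℕ) * Q ^ (-(2 : ℝ)) := by
    rw [show (Q ^ (7 : ℕ) : ℝ) = Q ^ (7 : ℝ) from (Real.rpow_natCast Q 7).symm, ← Real.rpow_add hQ0,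
      show (Q ^ (5 : ℕ) : ℝ) = Q ^ (5 : ℝ) from (Real.rpow_natCast Q 5).symm]
    norm_num
  have hx34pos : 0 < x ^ ((3 : ℝ) / 4) := Real.rpow_pos_of_pos hx0 _
  have hA : 3 * Q ^ (7 : ℕ) * (Real.log x + 1) * x ^ ((1 : ℝ) / 2) < c₁ / 8 * h := by
    rw [hx34]
    calc 3 * Q ^ (7 : ℕ) * (Real.log x + 1) * (x ^ (-((1 : ℝ) / 4)) * x ^ ((3 : ℝ) / 4))
        = (c₁ / 32) * ((96 / c₁) * Q ^ (7 : ℕ) * (Real.log x + 1) * x ^ (-((1 : ℝ) / 4))) * x ^ ((3 : ℝ) / 4) := by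
          field_simp; ring
      _ ≤ (c₁ / 32) * 1 * x ^ ((3 : ℝ) / 4) :=
          mul_le_mul_of_nonneg_right (mul_le_mul_of_nonneg_left habs' (by positivity)) hx34pos.le
      _ < (c₁ / 8) * 1 * x ^ ((3 : ℝ) / 4) := by
          refine mul_lt_mul_of_pos_right ?_ hx34pos
          nlinarith
      _ ≤ (c₁ / 8) * 1 * h := mul_le_mul_of_nonneg_left hx34h (by positivity)
      _ = c₁ / 8 * h := by ring
  have hkey : (NumberField.classNumber K : ℝ) * ((Module.finrank ℚ K : ℝ) * (Real.sqrt (x + h) + 1) * Real.log (x + h)) <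
      c₁ / 8 * Q ^ (-(2 : ℝ)) * h := by
    calc (NumberField.classNumber K : ℝ) * ((Module.finrank ℚ K : ℝ) * (Real.sqrt (x + h) + 1) * Real.log (x + h))
        ≤ Q ^ (4 : ℕ) * (Q * (3 * x ^ ((1 : ℝ) / 2)) * (Real.log x + 1)) := by
          refine mul_le_mul hhK (mul_le_mul (mul_le_mul hnQ hsqrt (by positivity) hQ0.le) hlogxh hlogxh0.le
            (by positivity)) (by positivity) (by positivity)
      _ = 3 * Q ^ (5 : ℕ) * (Real.log x + 1) * x ^ ((1 : ℝ) / 2) := by ring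
      _ = (3 * Q ^ (7 : ℕ) * (Real.log x + 1) * x ^ ((1 : ℝ) / 2)) * Q ^ (-(2 : ℝ)) := by rw [hQ52]; ring
      _ < (c₁ / 8 * h) * Q ^ (-(2 : ℝ)) := mul_lt_mul_of_pos_right hA hQm2
      _ = c₁ / 8 * Q ^ (-(2 : ℝ)) * h := by ring
  -- hence `#deg1(x+h) > #deg1(x)`
  have hΔθ : (NumberField.classNumber K : ℝ) * ((Module.finrank ℚ K : ℝ) * (Real.sqrt (x + h) + 1) * Real.log (x + h)) <
      (NumberField.classNumber K : ℝ) * (chebyshevThetaIdealClass K C (x + h) - chebyshevThetaIdealClass K C x) :=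
    lt_of_lt_of_le hkey hθ
  have hΔθ' : (Module.finrank ℚ K : ℝ) * (Real.sqrt (x + h) + 1) * Real.log (x + h) <
      chebyshevThetaIdealClass K C (x + h) - chebyshevThetaIdealClass K C x := lt_of_mul_lt_mul_left hΔθ hhKpos.le
  have hπ : (Module.finrank ℚ K : ℝ) * (Real.sqrt (x + h) + 1) <
      (primeIdealClassCount K C (x + h) : ℝ) - primeIdealClassCount K C x := by
    by_contra hle
    rw [not_lt] at hle
    have := mul_le_mul_of_nonneg_right hle hlogxh0.le
    linarith
  have hlt : (degOneClassCount K C x : ℝ) < degOneClassCount K C (x + h) := by linarith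
  have hlt' : degOneClassCount K C x < degOneClassCount K C (x + h) := by exact_mod_cast hlt
  unfold degOneClassCount at hlt'
  have hfin : {P : Ideal (𝓞 K) | (Ideal.absNorm P).Prime ∧ (Ideal.absNorm P : ℝ) ≤ x ∧
      ∃ hP : P ∈ (Ideal (𝓞 K))⁰, ClassGroup.mk0 ⟨P, hP⟩ = C}.Finite := by
    refine (Ideal.finite_setOf_absNorm_le (S := 𝓞 K) ⌊x⌋₊).subset ?_
    rintro P ⟨-, h2, -⟩
    exact Nat.le_floor h2
  obtain ⟨P, hPT, hPS⟩ := Set.exists_mem_notMem_of_ncard_lt_ncard hlt' hfin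
  obtain ⟨hPprime, hPle, hP0, hPC⟩ := hPT
  refine ⟨P, hPprime, ?_, hPle, hP0, hPC⟩
  by_contra hxP
  rw [not_lt] at hxP
  exact hPS ⟨hPprime, hxP, hP0, hPC⟩

end Summit.QuantumAdvantage.QuantumAdvantage.Theorems.DegreeOnePrimesEscape

end
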